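import Mathlib
import Summits.NavierStokesRegularity.NavierStokesRegularity.Theorems.EulerZoomLiouvillePowerGaugeEulerLiouvilleWeakCommutingLamb
import Summits.NavierStokesRegularity.NavierStokesRegularity.Theorems.EulerZoomLiouvillePowerGaugeEulerLiouvilleSelfSimilarPastProfileEquations
import HarnessLib

/-!
# Crux `EulerZoomLiouville.PowerGaugeEulerLiouville` (stmt-NavierStokesRegularity-19832), stubs `stub_selfSimilarWeakRest` and
# `stub_selfSimilarC2Needle`: NO CENTRALLY SYMMETRIC COLLAPSE — exactly self-similar members whose velocity profile is EVEN
# (`V(−y) = V(y)`, i.e. `u(τ,−x) = u(τ,x)`) are trivial, in the WEAK class (no regularity hypothesis) and hence in the `C²` class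

Helper file (theorems only; `--supports stmt-NavierStokesRegularity-19832`; def-free).  Hand leafhand-ns-eulerzoomliouville-10 g2; sequel of
hand g1's commutator lane (`…WeakCommutingVorticity`, `…WeakCommutingMember`, `…WeakCommutingLamb`).

The self-similar profile system `(1−γ)V + γ(y·∇)V + (V·∇)V + ∇P = 0`, `div V = 0` is invariant under the point reflection acting
EQUIVARIANTLY (`V ↦ −V(−·)`, odd profiles), but NOT under the INVARIANT action `V ↦ V(−·)`.  For an EVEN profile the linear part
`(1−γ)V + γ(y·∇)V` is even while the transport part `(V·∇)V` is odd, so the two decouple; on the vorticity side this says that the weak curls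
`ω_{v,w}` satisfy the Lamb-free curl-tested identity of hand g1, i.e. they are homogeneous distributions of degree `−1/γ`, which the class's
`L²_loc` gradient forbids (`WeakCommuting.ae_eq_zero_of_curlTested`).  Precisely, testing the tree's distributional profile equation
`ProfileEquation.weak_profile_equation` with a curl pair `η_ψ = (∂ᵥψ)w − (∂_wψ)v` AND with the curl pair of the reflected function
`ψ⁻ = ψ(−·)` (`η_{ψ⁻}(y) = −η_ψ(−y)`, `Dη_{ψ⁻}(y) = Dη_ψ(−y)`), and changing variables `y ↦ −y` (Lebesgue measure is reflection invariant,
`MeasureTheory.integral_neg_eq_self`), the Lamb term `∫⟪V, Dη[V]⟫` is the same for both while the linear terms change sign; subtracting,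

  `γ ∫⟪V, Dη_ψ[y]⟫ + (4γ − 1) ∫⟪V, η_ψ⟫ = 0`     for all `ψ ∈ C_c^∞`, `v, w ∈ ℝ³`

(`WeakEven.curlTested_of_even`) — exactly the hypothesis of hand g1's member theorem `Loc.selfSimilar_ae_eq_zero_of_weaklyCommuting_profile`.
The weak gradient with `‖G‖² ∈ L¹(B̄₁)` that theorem wants is supplied by the class itself (`Past.profileData_of_past`, the `E`-gauge), so the
member theorems below carry NO hypothesis beyond the crux's, exact self-similarity, and evenness:

* `WeakEven.curlTested_of_even` — profile level (`V, |V|², P ∈ L¹_loc`, the member's distributional Euler pair, `V` even);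
* `Loc.selfSimilar_ae_eq_zero_of_even_profile` — MEMBER LEVEL, hypotheses unbundled, every `0 < ρ ≤ ½`, no `C²`;
* `Birth.selfSimilar_of_evenProfile` — BY NAME in the skeleton's binders (`Birth.InClass`, `Birth.IsExactlySelfSimilar`): the centrally
  symmetric sub-stratum of BOTH open self-similar stubs (`stub_selfSimilarC2Needle`, `stub_selfSimilarWeakRest`) is CLOSED;
* `Birth.selfSimilar_of_evenMember` — the same with the symmetry put on the member, `u(τ,−x) = u(τ,x)` for `τ < 0`.

WHAT THIS IS NOT: not a proof of either stub or of the crux (the generic profile has no parity); nothing about Navier–Stokes. [folklore]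
-/

noncomputable section

-- flat `Theorems/<Route><Decl>…` files of one crux share the namespace of the crux (tree convention)
set_option linter.dupNamespace false

open MeasureTheory Set Filter Topology Metric Function TopologicalSpace
open scoped RealInnerProductSpace NNReal ENNReal ContDiff

namespace Summit.NavierStokesRegularity.NavierStokesRegularity.Theorems.PowerGaugeEulerLiouville

open Literature.Analysis Literature.Analysis.FunctionSpaces Literature.Analysis.FluidPDE

namespace WeakEven

/-! ### Calculus of the reflected test function -/

/-- Chain rule through the point reflection: `D(ψ(−·))(z)[h] = −Dψ(−z)[h]`. [folklore] -/
theorem fderiv_comp_neg_apply {F : Type*} [NormedAddCommGroup F] [NormedSpace ℝ F]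
    {ψ : EuclideanSpace ℝ (Fin 3) → F} (hψ : Differentiable ℝ ψ) (z h : EuclideanSpace ℝ (Fin 3)) :
    fderiv ℝ (fun z : EuclideanSpace ℝ (Fin 3) => ψ (-z)) z h = -(fderiv ℝ ψ (-z) h) := by
  have hneg : HasFDerivAt (fun z : EuclideanSpace ℝ (Fin 3) => -z)
      (-(ContinuousLinearMap.id ℝ (EuclideanSpace ℝ (Fin 3)))) z := (hasFDerivAt_id z).neg
  have hc : HasFDerivAt (fun z : EuclideanSpace ℝ (Fin 3) => ψ (-z))
      ((fderiv ℝ ψ (-z)).comp (-(ContinuousLinearMap.id ℝ (EuclideanSpace ℝ (Fin 3))))) z :=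
    (hψ (-z)).hasFDerivAt.comp z hneg
  rw [hc.fderiv]
  simp

/-- The reflected function `ψ(−·)` of a smooth `ψ` is smooth. [folklore] -/
theorem contDiff_comp_neg {ψ : EuclideanSpace ℝ (Fin 3) → ℝ} (hψ : ContDiff ℝ ∞ ψ) :
    ContDiff ℝ ∞ (fun z : EuclideanSpace ℝ (Fin 3) => ψ (-z)) :=
  hψ.comp contDiff_neg

/-- The reflected function `ψ(−·)` of a compactly supported `ψ` is compactly supported. [folklore] -/
theorem hasCompactSupport_comp_neg {ψ : EuclideanSpace ℝ (Fin 3) → ℝ} (hψs : HasCompactSupport ψ) :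
    HasCompactSupport (fun z : EuclideanSpace ℝ (Fin 3) => ψ (-z)) := by
  simpa only [Function.comp_def, Homeomorph.coe_neg] using hψs.comp_homeomorph (Homeomorph.neg (EuclideanSpace ℝ (Fin 3)))

/-- The curl pair of the reflected function is minus the reflected curl pair: `η_{ψ⁻}(z) = −η_ψ(−z)`. [folklore] -/
theorem curlPair_comp_neg {ψ : EuclideanSpace ℝ (Fin 3) → ℝ} (hψ : ContDiff ℝ ∞ ψ) (v w : EuclideanSpace ℝ (Fin 3)) :
    (fun z : EuclideanSpace ℝ (Fin 3) =>
        fderiv ℝ (fun z : EuclideanSpace ℝ (Fin 3) => ψ (-z)) z v • w - fderiv ℝ (fun z : EuclideanSpace ℝ (Fin 3) => ψ (-z)) z w • v) =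
      fun z : EuclideanSpace ℝ (Fin 3) => -(fderiv ℝ ψ (-z) v • w - fderiv ℝ ψ (-z) w • v) := by
  funext z
  have hd : Differentiable ℝ ψ := hψ.differentiable (by simp)
  rw [fderiv_comp_neg_apply hd, fderiv_comp_neg_apply hd, neg_smul, neg_smul]
  abel

/-- Derivative of the curl pair of the reflected function: `Dη_{ψ⁻}(y)[h] = Dη_ψ(−y)[h]`. [folklore] -/
theorem fderiv_curlPair_comp_neg_apply {ψ : EuclideanSpace ℝ (Fin 3) → ℝ} (hψ : ContDiff ℝ ∞ ψ) (hψs : HasCompactSupport ψ)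
    (v w y h : EuclideanSpace ℝ (Fin 3)) :
    fderiv ℝ (fun z : EuclideanSpace ℝ (Fin 3) =>
        fderiv ℝ (fun z : EuclideanSpace ℝ (Fin 3) => ψ (-z)) z v • w - fderiv ℝ (fun z : EuclideanSpace ℝ (Fin 3) => ψ (-z)) z w • v) y h =
      fderiv ℝ (fun z : EuclideanSpace ℝ (Fin 3) => fderiv ℝ ψ z v • w - fderiv ℝ ψ z w • v) (-y) h := by
  rw [curlPair_comp_neg hψ v w]
  have hηd : Differentiable ℝ (fun z : EuclideanSpace ℝ (Fin 3) => fderiv ℝ ψ z v • w - fderiv ℝ ψ z w • v) :=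
    (isTestFunctionOn_fderiv_smul_sub hψ hψs v w).contDiff.differentiable (by simp)
  rw [fderiv_fun_neg, neg_apply,
    fderiv_comp_neg_apply (ψ := fun z : EuclideanSpace ℝ (Fin 3) => fderiv ℝ ψ z v • w - fderiv ℝ ψ z w • v) hηd, neg_neg]

/-! ### The curl-tested identity of an even weak profile -/

variable {V : EuclideanSpace ℝ (Fin 3) → EuclideanSpace ℝ (Fin 3)} {P : EuclideanSpace ℝ (Fin 3) → ℝ}

/-- **EVEN WEAK PROFILES SATISFY THE LAMB-FREE CURL-TESTED IDENTITY.**  For an exactly self-similar distributional Euler pair with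
`V, |V|², P ∈ L¹_loc` and `V(−y) = V(y)` for all `y`, the tree's distributional profile equation tested with the curl pair of `ψ` and with the
curl pair of `ψ(−·)`, compared after the change of variables `y ↦ −y`, gives `γ ∫⟪V, Dη_ψ[y]⟫ + (4γ−1) ∫⟪V, η_ψ⟫ = 0`: the Lamb term is
reflection-even, the linear terms are reflection-odd. [folklore] -/
theorem curlTested_of_even {γ : ℝ}
    {u : ℝ → EuclideanSpace ℝ (Fin 3) → EuclideanSpace ℝ (Fin 3)} {p : ℝ → EuclideanSpace ℝ (Fin 3) → ℝ}
    (hsol : IsDistributionalNSSolutionOn (slab (EuclideanSpace ℝ (Fin 3)) (Iio 0) isOpen_Iio) 0 0 u p)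
    (hu : ∀ τ : ℝ, τ < 0 → u τ = selfSimilarCollapse γ 0 V τ)
    (hp : ∀ τ : ℝ, τ < 0 → p τ = selfSimilarCollapsePressure γ 0 P τ)
    (hV : LocallyIntegrable V volume) (hV2 : LocallyIntegrable (fun y => ‖V y‖ ^ 2) volume)
    (hP : LocallyIntegrable P volume)
    (heven : ∀ y : EuclideanSpace ℝ (Fin 3), V (-y) = V y) :
    ∀ ψ : EuclideanSpace ℝ (Fin 3) → ℝ, ContDiff ℝ ∞ ψ → HasCompactSupport ψ → ∀ v w : EuclideanSpace ℝ (Fin 3),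
      γ * (∫ y, ⟪V y, fderiv ℝ (fun z : EuclideanSpace ℝ (Fin 3) => fderiv ℝ ψ z v • w - fderiv ℝ ψ z w • v) y y⟫) +
        (4 * γ - 1) * (∫ y, ⟪V y, fderiv ℝ ψ y v • w - fderiv ℝ ψ y w • v⟫) = 0 := by
  intro ψ hψ hψs v w
  -- the curl pair `η` of `ψ` and the curl pair `ηm` of the reflected function `ψ(−·)`
  have hηT := isTestFunctionOn_fderiv_smul_sub hψ hψs v w
  have hψm := contDiff_comp_neg hψ
  have hψms := hasCompactSupport_comp_neg hψs
  have hηmT := isTestFunctionOn_fderiv_smul_sub hψm hψms v w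
  have hdivη : ∀ y, VectorCalculus.divergence
      (fun z : EuclideanSpace ℝ (Fin 3) => fderiv ℝ ψ z v • w - fderiv ℝ ψ z w • v) y = 0 :=
    isDivFree_fderiv_smul_sub hψ v w
  have hdivηm : ∀ y, VectorCalculus.divergence
      (fun z : EuclideanSpace ℝ (Fin 3) => fderiv ℝ (fun z : EuclideanSpace ℝ (Fin 3) => ψ (-z)) z v • w -
        fderiv ℝ (fun z : EuclideanSpace ℝ (Fin 3) => ψ (-z)) z w • v) y = 0 :=
    isDivFree_fderiv_smul_sub hψm v w
  -- the distributional profile equation tested with both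
  have H := ProfileEquation.weak_profile_equation hsol hu hp hV hV2 hP hηT
  have Hm := ProfileEquation.weak_profile_equation hsol hu hp hV hV2 hP hηmT
  simp only [hdivη, mul_zero, add_zero] at H
  simp only [hdivηm, mul_zero, add_zero] at Hm
  -- the sign-flipped `η`-integrand
  set F : EuclideanSpace ℝ (Fin 3) → ℝ := fun y =>
    ⟪V y, fderiv ℝ (fun z : EuclideanSpace ℝ (Fin 3) => fderiv ℝ ψ z v • w - fderiv ℝ ψ z w • v) y (V y)⟫ -
        γ * ⟪V y, fderiv ℝ (fun z : EuclideanSpace ℝ (Fin 3) => fderiv ℝ ψ z v • w - fderiv ℝ ψ z w • v) y y⟫ -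
      (4 * γ - 1) * ⟪V y, fderiv ℝ ψ y v • w - fderiv ℝ ψ y w • v⟫ with hF
  -- pointwise: the `ηm`-integrand at `y` is the sign-flipped `η`-integrand at `−y`
  have hkey : ∀ y : EuclideanSpace ℝ (Fin 3),
      ⟪V y, fderiv ℝ (fun z : EuclideanSpace ℝ (Fin 3) => fderiv ℝ (fun z : EuclideanSpace ℝ (Fin 3) => ψ (-z)) z v • w -
            fderiv ℝ (fun z : EuclideanSpace ℝ (Fin 3) => ψ (-z)) z w • v) y (V y)⟫ +
          γ * ⟪V y, fderiv ℝ (fun z : EuclideanSpace ℝ (Fin 3) => fderiv ℝ (fun z : EuclideanSpace ℝ (Fin 3) => ψ (-z)) z v • w -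
            fderiv ℝ (fun z : EuclideanSpace ℝ (Fin 3) => ψ (-z)) z w • v) y y⟫ +
        (4 * γ - 1) * ⟪V y, fderiv ℝ (fun z : EuclideanSpace ℝ (Fin 3) => ψ (-z)) y v • w -
            fderiv ℝ (fun z : EuclideanSpace ℝ (Fin 3) => ψ (-z)) y w • v⟫ = F (-y) := by
    intro y
    have hd : Differentiable ℝ ψ := hψ.differentiable (by simp)
    rw [hF]
    beta_reduce
    rw [fderiv_curlPair_comp_neg_apply hψ hψs v w y (V y), fderiv_curlPair_comp_neg_apply hψ hψs v w y y,
      fderiv_comp_neg_apply hd y v, fderiv_comp_neg_apply hd y w,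
      show -(fderiv ℝ ψ (-y) v) • w - -(fderiv ℝ ψ (-y) w) • v = -(fderiv ℝ ψ (-y) v • w - fderiv ℝ ψ (-y) w • v) by
        rw [neg_smul, neg_smul]; abel]
    simp only [heven, map_neg, inner_neg_right]
    ring
  -- change variables `y ↦ −y` in the `ηm` equation
  have h1 : ∫ y : EuclideanSpace ℝ (Fin 3), F (-y) = 0 := by
    rw [← Hm]
    exact integral_congr_ae (Filter.Eventually.of_forall fun y => (hkey y).symm)
  have Hm' : ∫ y : EuclideanSpace ℝ (Fin 3), F y = 0 := by
    rwa [integral_neg_eq_self F volume] at h1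
  simp only [hF] at Hm'
  -- integrability of the three integrands, then subtract
  have hI2 := WeakLamb.integrable_inner_fderiv_apply hV hV2 hηT
  have hI1 : Integrable (fun y => ⟪V y, fderiv ℝ (fun z : EuclideanSpace ℝ (Fin 3) => fderiv ℝ ψ z v • w - fderiv ℝ ψ z w • v) y y⟫)
      volume := WeakCommuting.integrable_inner_test hV (WeakLamb.isTestFunctionOn_fderiv_apply_self hηT)
  have hI0 : Integrable (fun y => ⟪V y, fderiv ℝ ψ y v • w - fderiv ℝ ψ y w • v⟫) volume :=
    WeakCommuting.integrable_inner_test hV hηT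
  have hC' : Integrable (fun y => γ *
      ⟪V y, fderiv ℝ (fun z : EuclideanSpace ℝ (Fin 3) => fderiv ℝ ψ z v • w - fderiv ℝ ψ z w • v) y y⟫) volume :=
    hI1.const_mul γ
  have hD' : Integrable (fun y => (4 * γ - 1) * ⟪V y, fderiv ℝ ψ y v • w - fderiv ℝ ψ y w • v⟫) volume :=
    hI0.const_mul _
  have hX : Integrable (fun y =>
      ⟪V y, fderiv ℝ (fun z : EuclideanSpace ℝ (Fin 3) => fderiv ℝ ψ z v • w - fderiv ℝ ψ z w • v) y (V y)⟫ +
        γ * ⟪V y, fderiv ℝ (fun z : EuclideanSpace ℝ (Fin 3) => fderiv ℝ ψ z v • w - fderiv ℝ ψ z w • v) y y⟫) volume :=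
    hI2.add hC'
  have hX' : Integrable (fun y =>
      ⟪V y, fderiv ℝ (fun z : EuclideanSpace ℝ (Fin 3) => fderiv ℝ ψ z v • w - fderiv ℝ ψ z w • v) y (V y)⟫ -
        γ * ⟪V y, fderiv ℝ (fun z : EuclideanSpace ℝ (Fin 3) => fderiv ℝ ψ z v • w - fderiv ℝ ψ z w • v) y y⟫) volume :=
    hI2.sub hC'
  rw [integral_add hX hD', integral_add hI2 hC', integral_const_mul, integral_const_mul] at H
  rw [integral_sub hX' hD', integral_sub hI2 hC', integral_const_mul, integral_const_mul] at Hm'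
  linarith

end WeakEven

/-- **MEMBER LEVEL: an exactly self-similar member of the weak class with an EVEN velocity profile is trivial** (every `0 < ρ ≤ ½`, no
regularity hypothesis).  Crux hypotheses verbatim, exact self-similarity about the origin at the class rate, `V(−y) = V(y)` for all `y`
⇒ `u = 0` a.e. on `(−∞,0) × ℝ³`.  Chain: `|V|² ∈ L¹_loc` (`A`-gauge), `P ∈ L¹_loc` (`D`-gauge), the class's profile gradient `G ∈ L²_loc`
(`Past.profileData_of_past`, `E`-gauge), `WeakEven.curlTested_of_even`, and hand g1's `Loc.selfSimilar_ae_eq_zero_of_weaklyCommuting_profile`.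
[folklore] -/
theorem Loc.selfSimilar_ae_eq_zero_of_even_profile {ρ : ℝ} (hρ : 0 < ρ) (hρh : ρ ≤ 1 / 2)
    {u : ℝ → EuclideanSpace ℝ (Fin 3) → EuclideanSpace ℝ (Fin 3)} {p : ℝ → EuclideanSpace ℝ (Fin 3) → ℝ}
    {H : ℝ → EuclideanSpace ℝ (Fin 3) → EuclideanSpace ℝ (Fin 3) →L[ℝ] EuclideanSpace ℝ (Fin 3)} {c : ℝ≥0}
    (hsw : IsSuitableWeakSolutionOn (slab (EuclideanSpace ℝ (Fin 3)) (Iio 0) isOpen_Iio) 0 0 u p)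
    (hH : HasWeakSpatialGradientOn (slab (EuclideanSpace ℝ (Fin 3)) (Iio 0) isOpen_Iio) u H)
    (hgauge : ∀ a : ℝ, 0 < a →
      ENNReal.ofReal (a ^ (2 * ρ)) * cknA a (0 : ℝ × EuclideanSpace ℝ (Fin 3)) u +
          ENNReal.ofReal (a ^ ρ) * cknE a (0 : ℝ × EuclideanSpace ℝ (Fin 3)) H +
        ENNReal.ofReal (a ^ (2 * ρ)) * cknD a (0 : ℝ × EuclideanSpace ℝ (Fin 3)) p ≤ (c : ℝ≥0∞))
    {V : EuclideanSpace ℝ (Fin 3) → EuclideanSpace ℝ (Fin 3)} {P : EuclideanSpace ℝ (Fin 3) → ℝ}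
    (hu : ∀ τ : ℝ, τ < 0 → u τ = selfSimilarCollapse (1 / (2 + ρ)) 0 V τ)
    (hp : ∀ τ : ℝ, τ < 0 → p τ = selfSimilarCollapsePressure (1 / (2 + ρ)) 0 P τ)
    (heven : ∀ y : EuclideanSpace ℝ (Fin 3), V (-y) = V y) :
    uncurry u =ᵐ[volume.restrict (Iio (0 : ℝ) ×ˢ (univ : Set (EuclideanSpace ℝ (Fin 3))))] 0 := by
  have hρ1 : ρ < 1 := by linarith
  have hA : ∀ a : ℝ, 0 < a → ENNReal.ofReal (a ^ (2 * ρ)) *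
      cknA a (0 : ℝ × EuclideanSpace ℝ (Fin 3)) u ≤ (c : ℝ≥0∞) :=
    fun a ha => le_trans (le_trans le_self_add le_self_add) (hgauge a ha)
  have hE : ∀ a : ℝ, 0 < a → ENNReal.ofReal (a ^ ρ) *
      cknE a (0 : ℝ × EuclideanSpace ℝ (Fin 3)) H ≤ (c : ℝ≥0∞) :=
    fun a ha => le_trans (le_trans le_add_self le_self_add) (hgauge a ha)
  have hD : ∀ a : ℝ, 0 < a → ENNReal.ofReal (a ^ (2 * ρ)) *
      cknD a (0 : ℝ × EuclideanSpace ℝ (Fin 3)) p ≤ (c : ℝ≥0∞) :=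
    fun a ha => le_trans le_add_self (hgauge a ha)
  -- the class's profile gradient (E-gauge)
  have hu' : ∀ τ : ℝ, τ < 0 → u τ = fun x => selfSimilarCollapse (1 / (2 + ρ)) 0 V τ (x - 0) :=
    fun τ hτ => by rw [hu τ hτ]; funext x; rw [sub_zero]
  have hp' : ∀ τ : ℝ, τ < 0 → p τ = fun x => selfSimilarCollapsePressure (1 / (2 + ρ)) 0 P τ (x - 0) :=
    fun τ hτ => by rw [hp τ hτ]; funext x; rw [sub_zero]
  obtain ⟨G, -, -, hGm, hVG, -, -, -, -, -, hG2, -⟩ :=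
    Past.profileData_of_past hρ hρh le_rfl le_rfl 0 hsw.distributional hH hA hE hD hu' hp'
  have hG : HasWeakGradient V G := hVG
  have hG2' : IntegrableOn (fun y => ‖G y‖ ^ 2) (closedBall (0 : EuclideanSpace ℝ (Fin 3)) 1) volume := by
    have h2 : Integrable (fun y => ‖G y‖ ^ 2) (volume.restrict (ball (0 : EuclideanSpace ℝ (Fin 3)) 2)) :=
      (memLp_two_iff_integrable_sq_norm (hG2 2).1).1 (hG2 2)
    exact IntegrableOn.mono_set h2 (closedBall_subset_ball (by norm_num))
  -- `V ∈ L¹_loc`, `|V|² ∈ L¹_loc` from the `A`-gauge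
  have hVli : LocallyIntegrable V volume := locallyIntegrableOn_univ.1 (by
    simpa only [Opens.coe_top] using hG.locallyIntegrableOn)
  have hV2 : LocallyIntegrable (fun y => ‖V y‖ ^ 2) volume :=
    EnergySaturation.locallyIntegrable_norm_sq_of_growth hVli.aestronglyMeasurable (profile_energy_growth_of_gaugeA hρ hu hA)
  -- `P ∈ L¹_loc` from the `D`-gauge
  have hpm : AEStronglyMeasurable (uncurry p)
      (volume.restrict (Iio (0 : ℝ) ×ˢ (univ : Set (EuclideanSpace ℝ (Fin 3))))) := by
    have := hsw.distributional.2.2.1.aestronglyMeasurable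
    simpa [slab] using this
  have hPm := aestronglyMeasurable_pressureProfile hpm hp
  have hDprof := profile_pressure_weight_of_gaugeD hρ hρ1 hpm hp hD
  have hP1 : LocallyIntegrable P volume :=
    EnergySaturation.locallyIntegrable_pressure_of_weight hρ1 hPm
      (ENNReal.mul_ne_top ENNReal.ofReal_ne_top ENNReal.coe_ne_top) hDprof
  -- the curl-tested identity from evenness, then hand g1's weak-class member theorem
  have hCT := WeakEven.curlTested_of_even hsw.distributional hu hp hVli hV2 hP1 heven
  exact Loc.selfSimilar_ae_eq_zero_of_weaklyCommuting_profile hρ hsw hH hgauge hu hG hG2' hCT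

/-- **THE CENTRALLY SYMMETRIC SUB-STRATUM OF BOTH SELF-SIMILAR STUBS IS CLOSED** (binder language of the skeleton of record, every
`0 < ρ ≤ ½`, no `C²` hypothesis): a class member (`Birth.InClass`) exactly self-similar about the origin (`Birth.IsExactlySelfSimilar ρ u p V P`)
whose velocity profile is even, `V(−y) = V(y)`, is trivial.  Inside the territory of `stub_selfSimilarWeakRest` and of
`stub_selfSimilarC2Needle`. [folklore] -/
theorem Birth.selfSimilar_of_evenProfile :
    ∀ ρ : ℝ, 0 < ρ → ρ ≤ 1 / 2 →
      ∀ (u : ℝ → EuclideanSpace ℝ (Fin 3) → EuclideanSpace ℝ (Fin 3)) (p : ℝ → EuclideanSpace ℝ (Fin 3) → ℝ)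
        (H : ℝ → EuclideanSpace ℝ (Fin 3) → EuclideanSpace ℝ (Fin 3) →L[ℝ] EuclideanSpace ℝ (Fin 3)) (c : ℝ≥0)
        (V : EuclideanSpace ℝ (Fin 3) → EuclideanSpace ℝ (Fin 3)) (P : EuclideanSpace ℝ (Fin 3) → ℝ),
        Birth.InClass ρ u p H c → Birth.IsExactlySelfSimilar ρ u p V P →
          (∀ y : EuclideanSpace ℝ (Fin 3), V (-y) = V y) →
          uncurry u =ᵐ[volume.restrict (Iio (0 : ℝ) ×ˢ (univ : Set (EuclideanSpace ℝ (Fin 3))))] 0 := by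
  intro ρ hρ hρh u p H c V P hcl hss heven
  exact Loc.selfSimilar_ae_eq_zero_of_even_profile hρ hρh hcl.1 hcl.2.1 hcl.2.2 hss.1 hss.2 heven

/-- **The same with the symmetry on the MEMBER**: a class member exactly self-similar about the origin with `u(τ,−x) = u(τ,x)` for all
`τ < 0` and all `x` is trivial (at `τ = −1` the ansatz reads `u(−1,x) = V(x)`, so the profile is even). [folklore] -/
theorem Birth.selfSimilar_of_evenMember :
    ∀ ρ : ℝ, 0 < ρ → ρ ≤ 1 / 2 →
      ∀ (u : ℝ → EuclideanSpace ℝ (Fin 3) → EuclideanSpace ℝ (Fin 3)) (p : ℝ → EuclideanSpace ℝ (Fin 3) → ℝ)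
        (H : ℝ → EuclideanSpace ℝ (Fin 3) → EuclideanSpace ℝ (Fin 3) →L[ℝ] EuclideanSpace ℝ (Fin 3)) (c : ℝ≥0)
        (V : EuclideanSpace ℝ (Fin 3) → EuclideanSpace ℝ (Fin 3)) (P : EuclideanSpace ℝ (Fin 3) → ℝ),
        Birth.InClass ρ u p H c → Birth.IsExactlySelfSimilar ρ u p V P →
          (∀ τ : ℝ, τ < 0 → ∀ x : EuclideanSpace ℝ (Fin 3), u τ (-x) = u τ x) →
          uncurry u =ᵐ[volume.restrict (Iio (0 : ℝ) ×ˢ (univ : Set (EuclideanSpace ℝ (Fin 3))))] 0 := by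
  intro ρ hρ hρh u p H c V P hcl hss hsym
  refine Birth.selfSimilar_of_evenProfile ρ hρ hρh u p H c V P hcl hss fun y => ?_
  have h1 := hsym (-1) (by norm_num) y
  rw [hss.1 (-1) (by norm_num)] at h1
  simpa [selfSimilarCollapse_apply] using h1

end Summit.NavierStokesRegularity.NavierStokesRegularity.Theorems.PowerGaugeEulerLiouville

end
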